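import Literature.AlgebraicGeometry.Motives.HodgeStructurePoincareFormulaPontryagin
import HarnessLib

/-!
# `x ⋆ 1 = τ(x) · 1`, `Λ^g x = g! τ(x) · 1`, `Λ^{g+1} = 0`, and the generating-function form of Poincaré's formula:
# `x ⋆ e^ω = e^Λ x` — the Pontryagin product with `e^θ = Σ_m θ^m/m!` (the Chern character of the principal polarization) is `exp(Λ_θ)`

[topic AlgebraicGeometry/Motives]

Layer `Literature/AlgebraicGeometry/Motives`, lane `lit-hodgefound` (Track 2 foundations library; prover seat `lit-hodgefound-p34`,
generation 36, row g36-#12). THEOREMS ONLY (no definition, no named fact, no instance, no notation; net debt `0`). Sequel of row g36-#9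
(`HodgeStructurePoincareFormulaPontryagin`: `x ⋆ ω^{[m]} = Λ^k x / k!` for `k + m = g`), g35-#2/#5 (`⋆`, unit `[0] = ω^g/g!`, `τ[0] = 1`,
`z = τ(z) [0]` on `⋀^{2g}`) and g29/g30 (`Λ` kills `⋀^{≤1}`, `⋀^{>2g} = 0`, `τ` vanishes off `⋀^{2g}`).

READING. On an abelian variety `X` of dimension `g`, `H⁰(X) ∋ 1 = [X]` is the fundamental class and `x ⋆ [X] = deg(x) [X]` for the degree
`deg = τ : H^{2g} → ℚ` (`x ⋆ [X] = μ_*(p^*x ∧ 1) = p₂… `: only top-degree classes survive): §1. By row g36-#9 with `k = g`: `x ⋆ 1 = Λ^g x / g!`,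
so **`Λ^g x = g! τ(x) · 1`** — the top divided power of the dual Lefschetz operator is the degree map — and `Λ^{g+1} = 0` (§2). Summing row
g36-#9 over `k + m = g`: **`x ⋆ (Σ_{m ≤ g} ω^m/m!) = Σ_{k ≤ g} Λ^k x / k!`**, i.e. `x ⋆ e^ω = e^Λ x` with both exponential series finite
(`ω^{g+1} = 0 = Λ^{g+1}`) — the Pontryagin product with the Chern character `e^θ` of the principal polarization is the exponential of `Λ_θ` (§3).

## Sources

H. Lange, *Abelian Varieties over the Complex Numbers* (2023) [Lange2023AbelianVarietiesComplex], §1.1 Exercise 1.1.6 (11) (p0028: the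
Pontryagin product, "commutative associative graded rings with identity `(0)_X`"), §2.5.3 Thm. 2.5.16 / Cor. 2.5.17 (d) (p0135: "`(D^g) = d_1 ⋯
d_g g! = (L^g)`"); D. Huybrechts, *Complex Geometry* [Huybrechts2005], Prop. 1.2.30 (the `𝔰𝔩₂`-triple `(L, Λ, H)`, `Λ` on primitive strings);
C. Voisin [Voisin2002], §6.2.1 Lemma 6.19. The exponential packaging of §3 is the generating-function restatement of row g36-#9 §2 (no
further source is claimed for it).

## What is proved (all `theorem`s)

* §1 `IsSymplectic.pontryagin_one_right` (`x ⋆ 1 = τ(x) · 1`), `IsSymplectic.pontryagin_one_left` (`1 ⋆ x = τ(x) · 1`).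
* §2 **`IsSymplectic.lefschetzDual_pow_genus_apply` (`Λ^g x = (g! τ(x)) · 1`)**, `IsSymplectic.lefschetzDual_pow_genus_succ` (`Λ^{g+1} = 0`).
* §3 **`IsSymplectic.pontryagin_sum_inv_factorial_smul_pow` (`x ⋆ Σ_{m ≤ g} ω^m/m! = Σ_{k ≤ g} Λ^k x/k!`)**.

TWIN NOTICE (RULING 29 bis): nothing of the torus-forms carriers is imported or restated.

## References

* [Lange2023AbelianVarietiesComplex] H. Lange, *Abelian Varieties over the Complex Numbers* (2023), §1.1 Exercise 1.1.6 (11) (p0028);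
  §2.5.3 Thm. 2.5.16, Cor. 2.5.17 (p0135).
* [Huybrechts2005] D. Huybrechts, *Complex Geometry* (2005), Prop. 1.2.30.
* [Voisin2002] C. Voisin, *Hodge Theory and Complex Algebraic Geometry I* (2002), §6.2.1 Lemma 6.19.
-/

noncomputable section

open scoped TensorProduct Nat

namespace Literature.AlgebraicGeometry.Motives

namespace ExteriorLefschetz

open ExteriorAlgebra

variable {K : Type*} [Field K] [CharZero K] {W : Type*} [AddCommGroup W] [Module K W] {ω : ExteriorAlgebra K W} {g : ℕ}

/-! ## §1 `x ⋆ 1 = τ(x) · 1` -/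

/-- **`x ⋆ 1 = τ(x) · 1`**: the Pontryagin product with the fundamental class `1 = [X] ∈ H⁰` is the degree `τ : H^{2g} → K` (times `[X]`);
it vanishes on `H^{<2g}` by degree. Proof on `⋀^{2g}`: `x = τ(x) [0]` and `[0] ⋆ 1 = 1`. [cite: Lange2023AbelianVarietiesComplex, §1.1 Exercise 1.1.6 (11) (p0028)] -/
theorem IsSymplectic.pontryagin_one_right (hω : IsSymplectic ω g) (x : ExteriorAlgebra K W) :
    hω.pontryagin x 1 = trace ω g x • (1 : ExteriorAlgebra K W) := by
  induction x using DirectSum.Decomposition.inductionOn (fun i : ℕ ↦ ⋀[K]^i W) with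
  | zero => rw [map_zero, LinearMap.zero_apply, map_zero, zero_smul]
  | add x y hx hy => rw [map_add, LinearMap.add_apply, hx, hy, map_add, add_smul]
  | @homogeneous p x =>
    by_cases hp : p = 2 * g
    · have hx := hω.eq_trace_smul_inv_factorial_smul_pow (z := (x : ExteriorAlgebra K W)) (hp ▸ x.2)
      conv_lhs => rw [hx, LinearMap.map_smul₂, hω.pontryagin_point_left]
    · rw [trace_apply_of_mem_ne x.2 hp, zero_smul]
      rcases lt_or_gt_of_ne hp with hlt | hgt
      · exact hω.pontryagin_eq_zero_of_add_lt (by omega : p + 0 < 2 * g) x.2 SetLike.GradedOne.one_mem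
      · have hx0 : (x : ExteriorAlgebra K W) = 0 := (Submodule.eq_bot_iff _).mp (hω.exteriorPower_eq_bot hgt) _ x.2
        rw [hx0, map_zero, LinearMap.zero_apply]

/-- **`1 ⋆ x = τ(x) · 1`** (graded commutativity: `1 ∈ H⁰` is even). [cite: Lange2023AbelianVarietiesComplex, §1.1 Exercise 1.1.6 (11) (p0028) and §2.5.3 Lemma 2.5.11 (p0133)] -/
theorem IsSymplectic.pontryagin_one_left (hω : IsSymplectic ω g) (x : ExteriorAlgebra K W) :
    hω.pontryagin 1 x = trace ω g x • (1 : ExteriorAlgebra K W) := by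
  induction x using DirectSum.Decomposition.inductionOn (fun i : ℕ ↦ ⋀[K]^i W) with
  | zero => rw [map_zero, map_zero, zero_smul]
  | add x y hx hy => rw [map_add, hx, hy, map_add, add_smul]
  | @homogeneous p x =>
    rw [hω.pontryagin_comm_of_mem SetLike.GradedOne.one_mem x.2, zero_mul, pow_zero, one_smul, hω.pontryagin_one_right]

/-! ## §2 `Λ^g x = g! τ(x) · 1` and `Λ^{g+1} = 0` -/

/-- **`Λ^g x = g! · τ(x) · 1`: THE TOP POWER OF THE DUAL LEFSCHETZ OPERATOR IS THE DEGREE MAP** (`x ⋆ 1 = Λ^g x / g!`, row g36-#9 with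
`k = g`, and §1). [cite: Huybrechts2005, Prop. 1.2.30] [cite: Lange2023AbelianVarietiesComplex, §2.5.3 Cor. 2.5.17 (d) (p0135)] -/
theorem IsSymplectic.lefschetzDual_pow_genus_apply (hω : IsSymplectic ω g) (x : ExteriorAlgebra K W) :
    (lefschetzDual ω g ^ g) x = ((g ! : K) * trace ω g x) • (1 : ExteriorAlgebra K W) := by
  have hg0 : (g ! : K) ≠ 0 := by exact_mod_cast Nat.factorial_ne_zero g
  have h := hω.pontryagin_inv_factorial_smul_pow_eq (k := g) (m := 0) (add_zero g) x
  rw [Nat.factorial_zero, Nat.cast_one, inv_one, pow_zero, one_smul, hω.pontryagin_one_right] at h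
  rw [mul_smul, h, smul_smul, mul_inv_cancel₀ hg0, one_smul]

/-- **`Λ^{g+1} = 0` on `H•(X) = ⋀W`** (`Λ^g x ∈ K · 1` and `Λ` kills `H⁰`). [cite: Huybrechts2005, Prop. 1.2.30] [cite: Voisin2002, §6.2.1 Lemma 6.19] -/
theorem IsSymplectic.lefschetzDual_pow_genus_succ (hω : IsSymplectic ω g) : lefschetzDual ω g ^ (g + 1) = 0 := by
  refine LinearMap.ext fun x ↦ ?_
  rw [pow_succ', Module.End.mul_apply, hω.lefschetzDual_pow_genus_apply, map_smul,
    lefschetzDual_apply_eq_zero_of_le_one ω g SetLike.GradedOne.one_mem (Nat.zero_le 1), smul_zero, LinearMap.zero_apply]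

/-! ## §3 `x ⋆ e^ω = e^Λ x` -/

/-- **`x ⋆ (Σ_{m=0}^{g} ω^m/m!) = Σ_{k=0}^{g} Λ^k x / k!` — `x ⋆ e^ω = e^Λ x`**: the Pontryagin product with the (finite) exponential
`e^ω = Σ_m ω^m/m!` of the principal polarization (its Chern character) is the (finite) exponential of the dual Lefschetz operator, summing
row g36-#9 `x ⋆ ω^{[m]} = Λ^{g−m} x/(g−m)!` over `m ≤ g`. [cite: Lange2023AbelianVarietiesComplex, §2.5.3 Thm. 2.5.16 (p0135)]
[cite: Huybrechts2005, Prop. 1.2.30] -/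
theorem IsSymplectic.pontryagin_sum_inv_factorial_smul_pow (hω : IsSymplectic ω g) (x : ExteriorAlgebra K W) :
    hω.pontryagin x (∑ m ∈ Finset.range (g + 1), (m ! : K)⁻¹ • ω ^ m) =
      ∑ k ∈ Finset.range (g + 1), (k ! : K)⁻¹ • (lefschetzDual ω g ^ k) x := by
  rw [map_sum, ← Finset.sum_range_reflect (fun k ↦ (k ! : K)⁻¹ • (lefschetzDual ω g ^ k) x) (g + 1)]
  refine Finset.sum_congr rfl fun m hm ↦ ?_
  rw [Finset.mem_range] at hm
  simp only [Nat.add_sub_cancel]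
  exact hω.pontryagin_inv_factorial_smul_pow_eq (by omega : (g - m) + m = g) x

end ExteriorLefschetz

end Literature.AlgebraicGeometry.Motives
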